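import Summits.ValiantsHypothesis.ValiantsHypothesis.Theorems.KPlusLogSqLawValuativeDoorNestedPairs
import Summits.ValiantsHypothesis.ValiantsHypothesis.Theorems.KPlusLogSqLawValuativeDoorSidonTwoSharpCore
import Summits.ValiantsHypothesis.ValiantsHypothesis.Theorems.KPlusLogSqLawValuativeDoorTwoAdicOnReals

/-!
# LINE `valuative_door` (crux `WeakLifting`, stmt-ValiantsHypothesis-19561) — the `m = 2` Sidon law is SHARP:
# for every `K`, a symmetric `2 × 2` Sidon pencil with `3K − 3` dominant exponents (`npEdges = 3K − 4`)

HONEST FRAMING.  Helper (cell `pub-symmetroid`, seat val-sym-lift-p1 g23, 2026-08-29; `--supports 19561 --as helper`).  Companion of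
`…ValuativeDoorSidonTwo.valSidonTwo_unfolded` (`npEdges ≤ 3K − 4` on Sidon supports): over ANY field with a non-archimedean absolute value
`v` and any element `π` with `0 < v π < 1` (e.g. `ℝ` with the tree's `TwoAdicOnReals`, `π = 2`), the explicit pencil `d_i = 2^i`,
`S_i = [[π^{(16i+20)2^i}, π^{(16i+9)2^i}], [π^{(16i+9)2^i}, π^{16i·2^i+1}]]` has at least `3K − 3` dominant exponents
(`valSidonTwo_sharp_unfolded`): the BAND exponents `2·2^k`, `2^k + 2^{k+1}`, `2^k + 2^{k+2}` dominate at the slopes `16k+32`, `16k+44`,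
`16k+51` (radius `r = (v π)^{-s}`), every coefficient having a unique `v`-largest term, so no residue condition enters
(`dominant_of_termwise` + the `ℕ`-inequalities of `…SidonTwoSharpCore`).  Hence the Sidon row of LINE (V) at `m = 2` is EXACTLY
`3K − 4 = ` the cell's tropical patchwork ceiling at `m = 2`.  Calibration only; no bearing on vW / vB, `TropicalB`, `MatrixDescartes`
(18050) or VP ≠ VNP.  [elementary; design = Gauss-norm picture, `exp/family2.py` of the seat]
-/

set_option linter.dupNamespace false
set_option autoImplicit false

namespace Summit.ValiantsHypothesis.ValiantsHypothesis.Theorems.KPlusLogSqLaw.ValDoor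

open Polynomial Finset Matrix
open scoped BigOperators Classical

variable {F : Type*} [Field F]

/-! ## §1 Small valuation tools -/

/-- `v (x + y) = v x` when `v y < v x` (non-archimedean). [folklore] -/
theorem abv_add_eq_left_of_lt (v : AbsoluteValue F ℝ) (hv : IsNonarchimedean v) {x y : F} (h : v y < v x) :
    v (x + y) = v x := by
  rw [IsNonarchimedean.add_eq_max_of_ne' v hv (fun a => (v.map_neg a).symm) h.ne', max_eq_left h.le]

/-- `v (x - y) ≤ max (v x) (v y)` (non-archimedean). [folklore] -/
theorem abv_sub_le_max_na (v : AbsoluteValue F ℝ) (hv : IsNonarchimedean v) (x y : F) : v (x - y) ≤ max (v x) (v y) := by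
  have h := hv x (-y)
  rwa [v.map_neg, ← sub_eq_add_neg] at h

/-- the slope trick: `n + s·E' < e + s·E` ⇒ `w^e · (w^{-s})^{E'} < w^n · (w^{-s})^E` for `0 < w < 1`. [elementary] -/
theorem pow_mul_lt_of_ineq {w : ℝ} (hw0 : 0 < w) (hw1 : w < 1) {n e s E E' : ℕ} (h : n + s * E' < e + s * E) :
    w ^ e * (w⁻¹ ^ s) ^ E' < w ^ n * (w⁻¹ ^ s) ^ E := by
  have key : w ^ (e + s * E) < w ^ (n + s * E') := pow_lt_pow_right_of_lt_one₀ hw0 hw1 h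
  rw [← pow_mul, ← pow_mul, inv_pow, inv_pow, ← div_eq_mul_inv, ← div_eq_mul_inv,
    div_lt_div_iff₀ (pow_pos hw0 _) (pow_pos hw0 _), ← pow_add, ← pow_add]
  exact key

/-! ## §2 Dominance from termwise inequalities -/

/-- **dominance from termwise inequalities.**  If every support exponent of `f` is a pair sum `d p + d q` whose coefficient is bounded
by the three term sizes `w^{A p + C q}`, `w^{A q + C p}`, `w^{B p + B q}`, the coefficient at `E` has size exactly `w^n`, and at the
integer slope `s` the target beats every term of every other pair sum (`n + s·(d p + d q) < e + s·E`), then `E` is a dominant exponent of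
`f` (radius `r = w^{-s}`). [elementary] -/
theorem dominant_of_termwise (v : AbsoluteValue F ℝ) {w : ℝ} (hw0 : 0 < w) (hw1 : w < 1) (f : F[X]) {K : ℕ}
    (d A B C : Fin K → ℕ) (E n s : ℕ)
    (hsupp : ∀ E' ∈ f.support, ∃ p q : Fin K, E' = d p + d q)
    (hbound : ∀ p q : Fin K, v (f.coeff (d p + d q)) ≤ max (max (w ^ (A p + C q)) (w ^ (A q + C p))) (w ^ (B p + B q)))
    (hval : v (f.coeff E) = w ^ n)
    (hineq : ∀ p q : Fin K, d p + d q ≠ E →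
      n + s * (d p + d q) < B p + B q + s * E ∧ n + s * (d p + d q) < A p + C q + s * E ∧
        n + s * (d p + d q) < A q + C p + s * E) :
    E ∈ f.support ∧ ∃ r : ℝ, 0 < r ∧ ∀ E' ∈ f.support, E' ≠ E → v (f.coeff E') * r ^ E' < v (f.coeff E) * r ^ E := by
  refine ⟨Polynomial.mem_support_iff.2 fun h0 => ?_, w⁻¹ ^ s, pow_pos (inv_pos.2 hw0) s, fun E' hE' hne => ?_⟩
  · rw [h0, map_zero] at hval
    exact absurd hval (ne_of_lt (pow_pos hw0 n))
  · obtain ⟨p, q, rfl⟩ := hsupp E' hE'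
    obtain ⟨h1, h2, h3⟩ := hineq p q hne
    rw [hval]
    have hr : 0 < (w⁻¹ ^ s) ^ (d p + d q) := pow_pos (pow_pos (inv_pos.2 hw0) s) _
    refine lt_of_le_of_lt (mul_le_mul_of_nonneg_right (hbound p q) hr.le) ?_
    rcases max_cases (max (w ^ (A p + C q)) (w ^ (A q + C p))) (w ^ (B p + B q)) with ⟨hm, -⟩ | ⟨hm, -⟩
    · rw [hm]
      rcases max_cases (w ^ (A p + C q)) (w ^ (A q + C p)) with ⟨hm', -⟩ | ⟨hm', -⟩
      · rw [hm']; exact pow_mul_lt_of_ineq hw0 hw1 h2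
      · rw [hm']; exact pow_mul_lt_of_ineq hw0 hw1 h3
    · rw [hm]; exact pow_mul_lt_of_ineq hw0 hw1 h1

/-! ## §3 The sharpness theorem -/

/-- **THE `m = 2` SIDON LAW IS SHARP, UNFOLDED:** over any field with a non-archimedean absolute value `v` and any `π` with
`0 < v π < 1`, for every `K` there is a symmetric `2 × 2` lacunary pencil with `K` letters on a Sidon support having at least `3K − 3`
dominant exponents (so `npEdges ≥ 3K − 4`, matching `valSidonTwo_unfolded`).  Witness: `d_i = 2^i`, `a_i = π^{(16i+20)2^i}`,
`b_i = π^{(16i+9)2^i}`, `c_i = π^{16i·2^i+1}`. [explicit cancellation-free family] -/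
theorem valSidonTwo_sharp_unfolded :
    ∀ (F : Type) [Field F] (v : AbsoluteValue F ℝ), IsNonarchimedean v → ∀ π : F, 0 < v π → v π < 1 → ∀ K : ℕ,
      ∃ (d : Fin K → ℕ) (S : Fin K → Matrix (Fin 2) (Fin 2) F), (∀ l, (S l).IsSymm) ∧
        (∀ l₁ l₂ l₃ l₄ : Fin K, d l₁ + d l₂ = d l₃ + d l₄ → (l₁ = l₃ ∧ l₂ = l₄) ∨ (l₁ = l₄ ∧ l₂ = l₃)) ∧
        3 * K - 3 ≤ ((Matrix.det (∑ l, ((Polynomial.X : Polynomial F) ^ d l) • (S l).map Polynomial.C)).support.filter fun E =>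
            ∃ r : ℝ, 0 < r ∧ ∀ E' ∈ (Matrix.det (∑ l, ((Polynomial.X : Polynomial F) ^ d l) • (S l).map Polynomial.C)).support,
              E' ≠ E →
              v ((Matrix.det (∑ l, ((Polynomial.X : Polynomial F) ^ d l) • (S l).map Polynomial.C)).coeff E') * r ^ E'
                < v ((Matrix.det (∑ l, ((Polynomial.X : Polynomial F) ^ d l) • (S l).map Polynomial.C)).coeff E) * r ^ E).card := by
  intro F _ v hv π hπ0 hπ1 K
  -- the family
  set A : Fin K → ℕ := fun l => (16 * (l : ℕ) + 20) * 2 ^ (l : ℕ) with hA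
  set B : Fin K → ℕ := fun l => (16 * (l : ℕ) + 9) * 2 ^ (l : ℕ) with hB
  set C : Fin K → ℕ := fun l => 16 * (l : ℕ) * 2 ^ (l : ℕ) + 1 with hC
  set d : Fin K → ℕ := fun l => 2 ^ (l : ℕ) with hd
  set S : Fin K → Matrix (Fin 2) (Fin 2) F := fun l => !![π ^ A l, π ^ B l; π ^ B l, π ^ C l] with hS
  have hS00 : ∀ l, S l 0 0 = π ^ A l := fun l => rfl
  have hS01 : ∀ l, S l 0 1 = π ^ B l := fun l => rfl
  have hS10 : ∀ l, S l 1 0 = π ^ B l := fun l => rfl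
  have hS11 : ∀ l, S l 1 1 = π ^ C l := fun l => rfl
  have hSymm : ∀ l, (S l).IsSymm := by
    intro l
    ext i j
    fin_cases i <;> fin_cases j <;> rfl
  have hsid : ∀ l₁ l₂ l₃ l₄ : Fin K, d l₁ + d l₂ = d l₃ + d l₄ → (l₁ = l₃ ∧ l₂ = l₄) ∨ (l₁ = l₄ ∧ l₂ = l₃) := by
    intro l₁ l₂ l₃ l₄ h
    rcases two_pow_sidon _ _ _ _ h with ⟨h1, h2⟩ | ⟨h1, h2⟩
    · exact Or.inl ⟨Fin.ext h1, Fin.ext h2⟩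
    · exact Or.inr ⟨Fin.ext h1, Fin.ext h2⟩
  refine ⟨d, S, hSymm, hsid, ?_⟩
  set f : F[X] := Matrix.det (∑ l, ((X : F[X]) ^ d l) • (S l).map (Polynomial.C : F →+* F[X])) with hf
  set w : ℝ := v π with hw
  -- coefficients
  have hoff : ∀ p q : Fin K, p ≠ q →
      f.coeff (d p + d q) = π ^ A p * π ^ C q + π ^ A q * π ^ C p - 2 * π ^ B p * π ^ B q := by
    intro p q hpq
    rw [hf, coeff_offdiag_of_sidonK d S hSymm hsid hpq, hS00, hS11, hS00, hS11, hS01, hS01]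
  have hdiag : ∀ p : Fin K, f.coeff (d p + d p) = π ^ A p * π ^ C p - π ^ B p * π ^ B p := by
    intro p
    rw [hf, coeff_diag_of_sidonK d S hSymm hsid p, hS00, hS11, hS01]
  have hsupp : ∀ E' ∈ f.support, ∃ p q : Fin K, E' = d p + d q := by
    intro E' hE'
    have hne := Polynomial.mem_support_iff.1 hE'
    rw [hf, coeff_det_symmPencil_two d S hSymm E'] at hne
    obtain ⟨pq, hpq, -⟩ := Finset.exists_ne_zero_of_sum_ne_zero hne
    exact ⟨pq.1, pq.2, ((Finset.mem_filter.1 hpq).2).symm⟩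
  -- sizes of terms
  have hvpow : ∀ a b : ℕ, v (π ^ a * π ^ b) = w ^ (a + b) := by
    intro a b
    rw [map_mul, map_pow, map_pow, ← pow_add]
  have hv2 : v 2 ≤ 1 := abv_two_le_one v hv
  have hbound : ∀ p q : Fin K,
      v (f.coeff (d p + d q)) ≤ max (max (w ^ (A p + C q)) (w ^ (A q + C p))) (w ^ (B p + B q)) := by
    intro p q
    by_cases hpq : p = q
    · subst hpq
      rw [hdiag]
      refine (abv_sub_le_max_na v hv _ _).trans ?_
      rw [hvpow, hvpow, max_self]
    · rw [hoff p q hpq]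
      refine (abv_sub_le_max_na v hv _ _).trans (max_le_max ((hv _ _).trans ?_) ?_)
      · rw [hvpow, hvpow]
      · rw [mul_assoc, map_mul, hvpow]
        exact mul_le_of_le_one_left (pow_nonneg (v.nonneg _) _) hv2
  -- exact sizes at the three target families
  have hwlt : ∀ {m m' : ℕ}, m < m' → w ^ m' < w ^ m := fun {m m'} h => pow_lt_pow_right_of_lt_one₀ hπ0 hπ1 h
  have hcancel : ∀ {n e t : ℕ}, n + t < e + t → n < e := fun {n e t} h => by omega
  have hval_diag : ∀ k : Fin K, v (f.coeff (d k + d k)) = w ^ (2 * B k) := by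
    intro k
    rw [hdiag, sub_eq_add_neg, add_comm, abv_add_eq_left_of_lt v hv]
    · rw [v.map_neg, hvpow, two_mul]
    · rw [v.map_neg, hvpow, hvpow, ← two_mul]
      exact hwlt (diag_min k)
  have hval_adj : ∀ k k' : Fin K, (k' : ℕ) = k + 1 → v (f.coeff (d k + d k')) = w ^ (A k + C k') := by
    intro k k' hk'
    have hne : k ≠ k' := fun h => by rw [h] at hk'; omega
    rw [hoff k k' hne, sub_eq_add_neg, abv_add_eq_left_of_lt v hv, abv_add_eq_left_of_lt v hv, hvpow]
    · rw [hvpow, hvpow]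
      refine hwlt (hcancel (t := (16 * (k : ℕ) + 44) * (2 ^ (k : ℕ) + 2 ^ (k' : ℕ))) ?_)
      have h := adj_vs_ac (k : ℕ) (k' : ℕ) (k : ℕ) (by omega)
      simp only [hA, hC, hk'] at h ⊢
      linarith [h, Nat.add_comm (2 ^ (k : ℕ)) (2 ^ ((k : ℕ) + 1))]
    · rw [abv_add_eq_left_of_lt v hv, v.map_neg, mul_assoc, map_mul, hvpow, hvpow]
      · refine lt_of_le_of_lt (mul_le_of_le_one_left (pow_nonneg (v.nonneg _) _) hv2) (hwlt ?_)
        refine hcancel (t := (16 * (k : ℕ) + 44) * (2 ^ (k : ℕ) + 2 ^ (k' : ℕ))) ?_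
        have h := adj_vs_bb (k : ℕ) (k : ℕ) (k' : ℕ)
        simp only [hA, hB, hC, hk'] at h ⊢
        linarith [h]
      · rw [hvpow, hvpow]
        refine hwlt (hcancel (t := (16 * (k : ℕ) + 44) * (2 ^ (k : ℕ) + 2 ^ (k' : ℕ))) ?_)
        have h := adj_vs_ac (k : ℕ) (k' : ℕ) (k : ℕ) (by omega)
        simp only [hA, hC, hk'] at h ⊢
        linarith [h, Nat.add_comm (2 ^ (k : ℕ)) (2 ^ ((k : ℕ) + 1))]
  have hval_skip : ∀ j j' : Fin K, (j' : ℕ) = j + 2 → v (f.coeff (d j + d j')) = w ^ (A j + C j') := by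
    intro j j' hj'
    have hne : j ≠ j' := fun h => by rw [h] at hj'; omega
    rw [hoff j j' hne, sub_eq_add_neg, abv_add_eq_left_of_lt v hv, abv_add_eq_left_of_lt v hv, hvpow]
    · rw [hvpow, hvpow]
      refine hwlt (hcancel (t := (16 * (j : ℕ) + 51) * (2 ^ (j : ℕ) + 2 ^ (j' : ℕ))) ?_)
      have h := skip_vs_ac (j : ℕ) (j' : ℕ) (j : ℕ) (by omega)
      simp only [hA, hC, hj'] at h ⊢
      linarith [h, Nat.add_comm (2 ^ (j : ℕ)) (2 ^ ((j : ℕ) + 2))]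
    · rw [abv_add_eq_left_of_lt v hv, v.map_neg, mul_assoc, map_mul, hvpow, hvpow]
      · refine lt_of_le_of_lt (mul_le_of_le_one_left (pow_nonneg (v.nonneg _) _) hv2) (hwlt ?_)
        refine hcancel (t := (16 * (j : ℕ) + 51) * (2 ^ (j : ℕ) + 2 ^ (j' : ℕ))) ?_
        have h := skip_vs_bb (j : ℕ) (j : ℕ) (j' : ℕ)
        simp only [hA, hB, hC, hj'] at h ⊢
        linarith [h]
      · rw [hvpow, hvpow]
        refine hwlt (hcancel (t := (16 * (j : ℕ) + 51) * (2 ^ (j : ℕ) + 2 ^ (j' : ℕ))) ?_)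
        have h := skip_vs_ac (j : ℕ) (j' : ℕ) (j : ℕ) (by omega)
        simp only [hA, hC, hj'] at h ⊢
        linarith [h, Nat.add_comm (2 ^ (j : ℕ)) (2 ^ ((j : ℕ) + 2))]
  -- the set of dominant exponents and the three target families
  set D := f.support.filter fun E => ∃ r : ℝ, 0 < r ∧ ∀ E' ∈ f.support, E' ≠ E →
      v (f.coeff E') * r ^ E' < v (f.coeff E) * r ^ E with hD
  have hpair_ne : ∀ (p q : Fin K) (a b : ℕ), d p + d q ≠ 2 ^ a + 2 ^ b →
      ¬ ((p : ℕ) = a ∧ (q : ℕ) = b) := by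
    rintro p q a b h ⟨rfl, rfl⟩
    exact h rfl
  have hdom_diag : ∀ k : Fin K, d k + d k ∈ D := by
    intro k
    refine Finset.mem_filter.2 (dominant_of_termwise v hπ0 hπ1 f d A B C (d k + d k) (2 * B k) (16 * k + 32) hsupp hbound
      (hval_diag k) fun p q hne => ⟨?_, ?_, ?_⟩)
    · have h := diag_vs_bb (k : ℕ) p q (hpair_ne p q k k hne)
      simp only [hB, hd] at h ⊢; linarith [h]
    · have h := diag_vs_ac (k : ℕ) p q
      simp only [hA, hB, hC, hd] at h ⊢; linarith [h]
    · have h := diag_vs_ac (k : ℕ) q p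
      simp only [hA, hB, hC, hd] at h ⊢; linarith [h, Nat.add_comm (2 ^ (p : ℕ)) (2 ^ (q : ℕ))]
  have hdom_adj : ∀ k k' : Fin K, (k' : ℕ) = k + 1 → d k + d k' ∈ D := by
    intro k k' hk'
    refine Finset.mem_filter.2 (dominant_of_termwise v hπ0 hπ1 f d A B C (d k + d k') (A k + C k') (16 * k + 44) hsupp hbound
      (hval_adj k k' hk') fun p q hne => ⟨?_, ?_, ?_⟩)
    · have h := adj_vs_bb (k : ℕ) p q
      simp only [hA, hB, hC, hd, hk'] at h hne ⊢; linarith [h]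
    · have h := adj_vs_ac (k : ℕ) p q (by simp only [hd, hk'] at hne; exact hpair_ne p q k (k + 1) hne)
      simp only [hA, hC, hd, hk'] at h ⊢; linarith [h]
    · have h := adj_vs_ac (k : ℕ) q p (by
        simp only [hd, hk'] at hne
        rintro ⟨h1, h2⟩
        exact hne (by rw [h1, h2, Nat.add_comm]))
      simp only [hA, hC, hd, hk'] at h ⊢; linarith [h, Nat.add_comm (2 ^ (p : ℕ)) (2 ^ (q : ℕ))]
  have hdom_skip : ∀ j j' : Fin K, (j' : ℕ) = j + 2 → d j + d j' ∈ D := by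
    intro j j' hj'
    refine Finset.mem_filter.2 (dominant_of_termwise v hπ0 hπ1 f d A B C (d j + d j') (A j + C j') (16 * j + 51) hsupp hbound
      (hval_skip j j' hj') fun p q hne => ⟨?_, ?_, ?_⟩)
    · have h := skip_vs_bb (j : ℕ) p q
      simp only [hA, hB, hC, hd, hj'] at h hne ⊢; linarith [h]
    · have h := skip_vs_ac (j : ℕ) p q (by simp only [hd, hj'] at hne; exact hpair_ne p q j (j + 2) hne)
      simp only [hA, hC, hd, hj'] at h ⊢; linarith [h]
    · have h := skip_vs_ac (j : ℕ) q p (by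
        simp only [hd, hj'] at hne
        rintro ⟨h1, h2⟩
        exact hne (by rw [h1, h2, Nat.add_comm]))
      simp only [hA, hC, hd, hj'] at h ⊢; linarith [h, Nat.add_comm (2 ^ (p : ℕ)) (2 ^ (q : ℕ))]
  -- counting: three disjoint injective families of sizes K, K − 1, K − 2
  set g₁ : Fin K → ℕ := fun k => 2 ^ (k : ℕ) + 2 ^ (k : ℕ) with hg₁
  set g₂ : Fin (K - 1) → ℕ := fun k => 2 ^ (k : ℕ) + 2 ^ ((k : ℕ) + 1) with hg₂
  set g₃ : Fin (K - 2) → ℕ := fun k => 2 ^ (k : ℕ) + 2 ^ ((k : ℕ) + 2) with hg₃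
  have hinj₁ : Function.Injective g₁ := by
    intro a b h
    rcases two_pow_sidon _ _ _ _ h with ⟨h1, -⟩ | ⟨h1, -⟩ <;> exact Fin.ext h1
  have hinj₂ : Function.Injective g₂ := by
    intro a b h
    rcases two_pow_sidon _ _ _ _ h with ⟨h1, -⟩ | ⟨h1, h2⟩
    · exact Fin.ext h1
    · exact Fin.ext (by omega)
  have hinj₃ : Function.Injective g₃ := by
    intro a b h
    rcases two_pow_sidon _ _ _ _ h with ⟨h1, -⟩ | ⟨h1, h2⟩
    · exact Fin.ext h1
    · exact Fin.ext (by omega)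
  set T₁ : Finset ℕ := (univ : Finset (Fin K)).image g₁ with hT₁
  set T₂ : Finset ℕ := (univ : Finset (Fin (K - 1))).image g₂ with hT₂
  set T₃ : Finset ℕ := (univ : Finset (Fin (K - 2))).image g₃ with hT₃
  have hT₁D : T₁ ⊆ D := by
    intro E hE
    obtain ⟨k, -, rfl⟩ := Finset.mem_image.1 hE
    exact hdom_diag k
  have hT₂D : T₂ ⊆ D := by
    intro E hE
    obtain ⟨k, -, rfl⟩ := Finset.mem_image.1 hE
    have hk0 := k.isLt
    have hk : (k : ℕ) + 1 < K := by omega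
    exact hdom_adj ⟨k, by omega⟩ ⟨(k : ℕ) + 1, hk⟩ rfl
  have hT₃D : T₃ ⊆ D := by
    intro E hE
    obtain ⟨k, -, rfl⟩ := Finset.mem_image.1 hE
    have hk0 := k.isLt
    have hk : (k : ℕ) + 2 < K := by omega
    exact hdom_skip ⟨k, by omega⟩ ⟨(k : ℕ) + 2, hk⟩ rfl
  have hc₁ : T₁.card = K := by
    rw [hT₁, Finset.card_image_of_injective _ hinj₁, Finset.card_univ, Fintype.card_fin]
  have hc₂ : T₂.card = K - 1 := by
    rw [hT₂, Finset.card_image_of_injective _ hinj₂, Finset.card_univ, Fintype.card_fin]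
  have hc₃ : T₃.card = K - 2 := by
    rw [hT₃, Finset.card_image_of_injective _ hinj₃, Finset.card_univ, Fintype.card_fin]
  have hdisj₁₂ : Disjoint T₁ T₂ := by
    rw [Finset.disjoint_left]
    intro E h1 h2
    obtain ⟨a, -, rfl⟩ := Finset.mem_image.1 h1
    obtain ⟨b, -, hb⟩ := Finset.mem_image.1 h2
    rcases two_pow_sidon _ _ _ _ hb with ⟨e1, e2⟩ | ⟨e1, e2⟩ <;> omega
  have hdisj₁₃ : Disjoint T₁ T₃ := by
    rw [Finset.disjoint_left]
    intro E h1 h2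
    obtain ⟨a, -, rfl⟩ := Finset.mem_image.1 h1
    obtain ⟨b, -, hb⟩ := Finset.mem_image.1 h2
    rcases two_pow_sidon _ _ _ _ hb with ⟨e1, e2⟩ | ⟨e1, e2⟩ <;> omega
  have hdisj₂₃ : Disjoint T₂ T₃ := by
    rw [Finset.disjoint_left]
    intro E h1 h2
    obtain ⟨a, -, rfl⟩ := Finset.mem_image.1 h1
    obtain ⟨b, -, hb⟩ := Finset.mem_image.1 h2
    rcases two_pow_sidon _ _ _ _ hb with ⟨e1, e2⟩ | ⟨e1, e2⟩ <;> omega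
  have hunion : (T₁ ∪ T₂ ∪ T₃).card = K + (K - 1) + (K - 2) := by
    rw [Finset.card_union_of_disjoint (Finset.disjoint_union_left.2 ⟨hdisj₁₃, hdisj₂₃⟩),
      Finset.card_union_of_disjoint hdisj₁₂, hc₁, hc₂, hc₃]
  have hsub : T₁ ∪ T₂ ∪ T₃ ⊆ D := Finset.union_subset (Finset.union_subset hT₁D hT₂D) hT₃D
  have := Finset.card_le_card hsub
  rw [hunion] at this
  show 3 * K - 3 ≤ D.card
  omega

/-- **SHARPNESS OVER `ℝ` (characteristic zero, as in the custody row `ValRootLawAt`):** with the tree's 2-adic place of `ℝ`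
(`…TwoAdicOnReals.twoAdicOnReals_unfolded`, `π = 2`), for every `K` some real symmetric `2 × 2` Sidon pencil has at least `3K − 3`
dominant exponents — so no bound below `3K − 4` holds for the Sidon-restricted `(2, K)` valuative row. [corollary] -/
theorem valSidonTwo_sharp_real (K : ℕ) :
    ∃ (w : AbsoluteValue ℝ ℝ) (d : Fin K → ℕ) (S : Fin K → Matrix (Fin 2) (Fin 2) ℝ), IsNonarchimedean w ∧ (∀ l, (S l).IsSymm) ∧
      (∀ l₁ l₂ l₃ l₄ : Fin K, d l₁ + d l₂ = d l₃ + d l₄ → (l₁ = l₃ ∧ l₂ = l₄) ∨ (l₁ = l₄ ∧ l₂ = l₃)) ∧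
      3 * K - 3 ≤ ((Matrix.det (∑ l, ((Polynomial.X : Polynomial ℝ) ^ d l) • (S l).map Polynomial.C)).support.filter fun E =>
          ∃ r : ℝ, 0 < r ∧ ∀ E' ∈ (Matrix.det (∑ l, ((Polynomial.X : Polynomial ℝ) ^ d l) • (S l).map Polynomial.C)).support,
            E' ≠ E →
            w ((Matrix.det (∑ l, ((Polynomial.X : Polynomial ℝ) ^ d l) • (S l).map Polynomial.C)).coeff E') * r ^ E'
              < w ((Matrix.det (∑ l, ((Polynomial.X : Polynomial ℝ) ^ d l) • (S l).map Polynomial.C)).coeff E) * r ^ E).card := by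
  obtain ⟨w, hw, hw2⟩ := twoAdicOnReals_unfolded
  obtain ⟨d, S, hS, hsid, hcard⟩ := valSidonTwo_sharp_unfolded ℝ w hw 2 (w.pos two_ne_zero) hw2 K
  exact ⟨w, d, S, hw, hS, hsid, hcard⟩

end Summit.ValiantsHypothesis.ValiantsHypothesis.Theorems.KPlusLogSqLaw.ValDoor
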